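import Literature.Probability.RandomPlanarGeometry.SAWAdsorptionFreeEnergy
import Literature.Probability.RandomPlanarGeometry.SAWAdsorptionConvexity
import Literature.Probability.RandomPlanarGeometry.SAWAdsorptionWindow
import Literature.Probability.RandomPlanarGeometry.SAWAdsorptionUpperBound207
import Literature.Probability.RandomPlanarGeometry.SAWDimensionTransfer
import Mathlib.Analysis.Convex.Continuous
import Mathlib.Analysis.Calculus.Monotone
import HarnessLib

/-!
# The adsorption free energy `κ(a)` of the half-plane self-avoiding walk as a function of the fugacity:
# `e^{κ(a)} ≥ max(μ, a)`, monotone, log-convex, and `AdsorbedAbove a Λ ⇔ Λ` below the rate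

Topic `Literature/Probability/RandomPlanarGeometry` (continues `SAWAdsorptionFreeEnergy.lean` — the existence of
`lim Z⁺_n(a)^{1/n}` for every `a ≥ 0`, `Zd.exists_tendsto_adsZ_rpow` — and `SAWAdsorptionConvexity.lean`, Hölder's
`Z⁺_n(a^θ b^{1-θ}) ≤ Z⁺_n(a)^θ Z⁺_n(b)^{1-θ}`).

Beaton–Guttmann–Jensen 2012 (§1 pp. 1–2 of arXiv:1110.6695v1; after Hammersley–Torrie–Whittington 1982 and Whittington 1975): the free
energy `κ(α) = lim n⁻¹ log Z_n(α)` «is a convex, non-decreasing function of `α`», «For `α < 0`, `κ(α) = log μ`», «For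
`α ≥ 0`, `κ(α) ≥ max[log μ, α]`» (`a = e^α`). With **`Zd.adsRate a := lim_n Z⁺_n(a)^{1/n} = e^{κ(a)}`** (`Zd.tendsto_adsRate`):

* `Zd.adsRate_eq_connectiveConstant` — `e^{κ(a)} = μ` for `0 ≤ a ≤ 1`;
* `Zd.max_le_adsRate` — **`e^{κ(a)} ≥ max(μ, a)`** for `a ≥ 0` (as printed);
* `Zd.adsRate_le_mul_connectiveConstant` — `e^{κ(a)} ≤ a μ` for `a ≥ 1`; together **Owczarek–Whittington 2009 (12.15)–(12.16)
  as printed**: «`max[κ₂, α] ≤ κ(α) ≤ κ₂ + α`, `α ≥ 0`» and «`κ(α) = κ₂`, `α ≤ 0`» (`Zd.OwczarekWhittington2009_eq_12_15/16`);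
* `Zd.adsRate_mono` — **non-decreasing**; `Zd.adsRate_logConvex` — **`e^{κ}` is log-convex in `log a`**:
  `adsRate (a^θ b^{1-θ}) ≤ (adsRate a)^θ (adsRate b)^{1-θ}` (i.e. `κ` convex in `α`);
* `Zd.le_adsRate_of_adsorbedAbove` / `Zd.adsorbedAbove_of_lt_adsRate` — the finite certificate `AdsorbedAbove a Λ`
  (`∃ K > 0, ∀ n, K Λⁿ ≤ Z⁺_n(a)`) holds for every `Λ < e^{κ(a)}` and only for `Λ ≤ e^{κ(a)}`; hence
  `Zd.connectiveConstant_lt_adsRate_207` — **`e^{κ(2.07)} ≥ 2.69 > μ(ℤ²)`: the walk is adsorbed at `a = 2.07`**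
  (`Zd.adsorbedAbove_207`, `Zd.connectiveConstant_two_lt_269`), while `e^{κ(a)} = μ` for `a ≤ 1`: `1 < a_c ≤ 2.07`.

* `Zd.adsCriticalFugacity = a_c := sup {a ≥ 0 : e^{κ(a)} = μ}` with `a_c ≤ μ` as printed («`0 ≤ α_c ≤ log μ`», pure std),
  `e^{κ(a_c)} = μ` (continuity), and **`1 ≤ a_c ≤ 2.07`** (`Zd.one_le_adsCriticalFugacity`,
  `Zd.adsCriticalFugacity_le_207`), hence **`a_c < μ(ℤ²)` strictly** (`Zd.adsCriticalFugacity_lt_connectiveConstant`, via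
  Temperley's `1 + √2 ≤ μ`; in print only `a_c ≤ μ`), `e^{κ(a)} = μ` for `a < a_c` and `e^{κ(a)} > μ` for `a > a_c`.

* `Zd.adsFreeEnergy α = κ(α) = log e^{κ}(e^α)` with the printed sentences verbatim: `κ(α) = log μ` for `α ≤ 0`,
  `max[log μ, α] ≤ κ(α) ≤ log μ + α` for `α ≥ 0`, **monotone, convex (`ConvexOn ℝ univ`), continuous, a.e. differentiable**.

Label: CONSOLIDATION (printed properties of `κ`, BGJ 2012 p. 2; O–W 2009 (12.15)–(12.16)) + the lane's certified window, now
as statements about the limit and the critical fugacity themselves. Pure standard axioms except `connectiveConstant_lt_adsRate_207` (inherits the census `native_decide` certificates).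
-/

noncomputable section

open Finset Filter Topology Literature.Probability.LatticeModels
open scoped BigOperators

namespace Literature.Probability.RandomPlanarGeometry.SAW.Zd

/-- **`e^{κ(a)}`**: the growth rate `lim_n Z⁺_n(a)^{1/n}` of the adsorption partition function (the limit exists for
`a ≥ 0`, `Zd.exists_tendsto_adsZ_rpow`; junk for `a < 0`). The printed statement is for `a = e^α > 0`; the member `a = 0`
of this family is the count of half-plane walks that never return to the wall (limit `μ`, Whittington 1975 as cited by
BGJ 2012 p. 2). [cite: BeatonGuttmannJensen2012Adsorption, §1 p. 1 (arXiv:1110.6695v1)]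
[cite: HammersleyTorrieWhittington1982, existence of the free energy κ; reported in BeatonGuttmannJensen2012Adsorption §1 p. 1 (arXiv:1110.6695v1)] -/
def adsRate (a : ℝ) : ℝ := limUnder atTop fun n : ℕ => (adsZ n a) ^ (1 / (n : ℝ))

/-- `Z⁺_n(a)^{1/n} → e^{κ(a)}` (`a ≥ 0`). [cite: BeatonGuttmannJensen2012Adsorption, §1 p. 1 (arXiv:1110.6695v1)] -/
theorem tendsto_adsRate {a : ℝ} (ha : 0 ≤ a) :
    Tendsto (fun n : ℕ => (adsZ n a) ^ (1 / (n : ℝ))) atTop (𝓝 (adsRate a)) := by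
  obtain ⟨K, -, hK⟩ := exists_tendsto_adsZ_rpow ha
  exact tendsto_nhds_limUnder ⟨K, hK⟩

/-- **`e^{κ(a)} = μ` for `0 ≤ a ≤ 1`** («For `α < 0`, `κ(α) = log μ`», and at `α = 0`).
[cite: BeatonGuttmannJensen2012Adsorption, §1 p. 2 (arXiv:1110.6695v1: «For α < 0, κ(α) = log μ»)] -/
theorem adsRate_eq_connectiveConstant {a : ℝ} (ha0 : 0 ≤ a) (ha1 : a ≤ 1) : adsRate a = connectiveConstant 2 :=
  tendsto_nhds_unique (tendsto_adsRate ha0) (tendsto_adsZ_rpow_of_le_one ha0 ha1)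

/-- **`e^{κ(a)} = max(β(a), μ)` for `a ≥ 1`**, `β(a)` the growth rate of wall-returning `x`-bridges.
[cite: HammersleyTorrieWhittington1982, existence of the free energy κ; reported in BeatonGuttmannJensen2012Adsorption §1 p. 1 (arXiv:1110.6695v1)] -/
theorem adsRate_eq_max {a β : ℝ} (ha : 1 ≤ a) (hβ0 : 0 < β)
    (hβlim : Tendsto (fun n : ℕ => (AdsIrr.Bw n a) ^ (1 / (n : ℝ))) atTop (𝓝 β))
    (hβ : ∀ m, AdsIrr.Bw m a ≤ β ^ m) : adsRate a = max β (connectiveConstant 2) :=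
  eq_max_of_tendsto_adsZ_rpow ha hβ0 hβlim hβ (tendsto_adsRate (zero_le_one.trans ha))

/-- `μ ≤ e^{κ(a)}` (`a ≥ 0`). [cite: BeatonGuttmannJensen2012Adsorption, §1 p. 2 (arXiv:1110.6695v1: «κ(α) ≥ max[log μ, α]»)] -/
theorem connectiveConstant_le_adsRate {a : ℝ} (ha : 0 ≤ a) : connectiveConstant 2 ≤ adsRate a := by
  obtain ⟨K, hK, hlim⟩ := exists_tendsto_adsZ_rpow ha
  rwa [← tendsto_nhds_unique (tendsto_adsRate ha) hlim] at hK

/-- `a ≤ e^{κ(a)}` (`a ≥ 0`): the walk along the wall, `aⁿ ≤ Z⁺_n(a)`. [cite: BeatonGuttmannJensen2012Adsorption, §1 p. 2 (arXiv:1110.6695v1: «κ(α) ≥ max[log μ, α]»)] -/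
theorem self_le_adsRate {a : ℝ} (ha : 0 ≤ a) : a ≤ adsRate a := by
  refine le_of_tendsto_of_tendsto' tendsto_const_nhds
    ((tendsto_adsRate ha).comp (tendsto_add_atTop_nat 1)) fun n => ?_
  have hn : (n + 1 : ℕ) ≠ 0 := Nat.succ_ne_zero n
  calc a = (a ^ (n + 1)) ^ (1 / ((n + 1 : ℕ) : ℝ)) := by rw [one_div, Real.pow_rpow_inv_natCast ha hn]
    _ ≤ (adsZ (n + 1) a) ^ (1 / ((n + 1 : ℕ) : ℝ)) :=
        Real.rpow_le_rpow (pow_nonneg ha _) (pow_le_adsZ (n + 1) ha) (by positivity)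

/-- **`e^{κ(a)} ≥ max(μ, a)`** for `a ≥ 0` — as printed: «For `α ≥ 0`, `κ(α) ≥ max[log μ, α]`».
[cite: BeatonGuttmannJensen2012Adsorption, §1 p. 2 (arXiv:1110.6695v1: «κ(α) ≥ max[log μ, α]»)] -/
theorem max_le_adsRate {a : ℝ} (ha : 0 ≤ a) : max (connectiveConstant 2) a ≤ adsRate a :=
  max_le (connectiveConstant_le_adsRate ha) (self_le_adsRate ha)

/-- At most `n` wall visits in `n` steps. [cite: BeatonGuttmannJensen2012Adsorption, §1 (p. 2)] -/
theorem wallVisits_le (n : ℕ) (ω : ℕ → Site 2) : wallVisits n ω ≤ n := by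
  classical
  unfold wallVisits
  calc ((Finset.range (n + 1)).filter fun k => 1 ≤ k ∧ ω k 0 = 0).card ≤ (Finset.Icc 1 n).card :=
        Finset.card_le_card fun k hk => by
          simp only [Finset.mem_filter, Finset.mem_range] at hk
          exact Finset.mem_Icc.2 ⟨hk.2.1, Nat.le_of_lt_succ hk.1⟩
    _ = n := by simp

/-- `Z⁺_n(a) ≤ aⁿ c_n` for `a ≥ 1`. [cite: OwczarekWhittington2009InteractingPolygons, §12.2.1 eq. (12.15)] -/
theorem adsZ_le_pow_mul_count (n : ℕ) {a : ℝ} (ha : 1 ≤ a) : adsZ n a ≤ a ^ n * (count 2 n : ℝ) := by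
  classical
  unfold adsZ
  calc ∑ ω ∈ hpWalks n, a ^ wallVisits n ω ≤ ∑ _ω ∈ hpWalks n, a ^ n :=
        Finset.sum_le_sum fun ω _ => pow_le_pow_right₀ ha (wallVisits_le n ω)
    _ = (hpWalks n).card * a ^ n := by rw [Finset.sum_const, nsmul_eq_mul]
    _ ≤ (count 2 n : ℝ) * a ^ n := by
        refine mul_le_mul_of_nonneg_right ?_ (pow_nonneg (zero_le_one.trans ha) _)
        rw [← card_saws]
        exact_mod_cast Finset.card_le_card (Finset.filter_subset _ _)
    _ = a ^ n * (count 2 n : ℝ) := mul_comm _ _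

/-- **`e^{κ(a)} ≤ a · μ` for `a ≥ 1`** — as printed: «`κ(α) ≤ κ₂ + α`, `α ≥ 0`» (at most `n` visits).
[cite: OwczarekWhittington2009InteractingPolygons, §12.2.1 eq. (12.15)] -/
theorem adsRate_le_mul_connectiveConstant {a : ℝ} (ha : 1 ≤ a) : adsRate a ≤ a * connectiveConstant 2 := by
  have h0 : 0 ≤ a := zero_le_one.trans ha
  have hup : Tendsto (fun n : ℕ => a * (count 2 n : ℝ) ^ (1 / (n : ℝ))) atTop (𝓝 (a * connectiveConstant 2)) :=
    (tendsto_count_rpow 2).const_mul a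
  refine le_of_tendsto_of_tendsto (tendsto_adsRate h0) hup ?_
  filter_upwards [eventually_ge_atTop 1] with n hn
  calc (adsZ n a) ^ (1 / (n : ℝ)) ≤ (a ^ n * (count 2 n : ℝ)) ^ (1 / (n : ℝ)) :=
        Real.rpow_le_rpow (adsZ_nonneg n h0) (adsZ_le_pow_mul_count n ha) (by positivity)
    _ = a * (count 2 n : ℝ) ^ (1 / (n : ℝ)) := by
        rw [Real.mul_rpow (pow_nonneg h0 _) (Nat.cast_nonneg _), one_div, Real.pow_rpow_inv_natCast h0 (by omega)]

/-- **(12.15) as printed, on `e^{κ}`: `max(μ, a) ≤ e^{κ(a)} ≤ μ · a` for `a ≥ 1`** («For the walk problem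
`max[κ₂, α] ≤ κ(α) ≤ κ₂ + α`, `α ≥ 0`», `κ₂ = log μ(ℤ²)`, `a = e^α`).
[cite: OwczarekWhittington2009InteractingPolygons, §12.2.1 eq. (12.15)] -/
theorem OwczarekWhittington2009_eq_12_15 {a : ℝ} (ha : 1 ≤ a) :
    max (connectiveConstant 2) a ≤ adsRate a ∧ adsRate a ≤ connectiveConstant 2 * a :=
  ⟨max_le_adsRate (zero_le_one.trans ha), by rw [mul_comm]; exact adsRate_le_mul_connectiveConstant ha⟩

/-- **(12.16) as printed: `κ(α) = κ₂` for `α ≤ 0`**, i.e. `e^{κ(a)} = μ` for `0 < a ≤ 1` (and at `a = 0`).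
[cite: OwczarekWhittington2009InteractingPolygons, §12.2.1 eq. (12.16)] -/
theorem OwczarekWhittington2009_eq_12_16 {a : ℝ} (ha0 : 0 ≤ a) (ha1 : a ≤ 1) : adsRate a = connectiveConstant 2 :=
  adsRate_eq_connectiveConstant ha0 ha1

/-- `e^{κ(a)} > 0`. [cite: BeatonGuttmannJensen2012Adsorption, §1 (p. 2)] -/
theorem adsRate_pos {a : ℝ} (ha : 0 ≤ a) : 0 < adsRate a :=
  (connectiveConstant_pos 2).trans_le (connectiveConstant_le_adsRate ha)

/-- **`κ` is non-decreasing**: `a ≤ b ⇒ e^{κ(a)} ≤ e^{κ(b)}`. [cite: BeatonGuttmannJensen2012Adsorption, §1 p. 1 (arXiv:1110.6695v1: «a convex, non-decreasing function of α»)] -/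
theorem adsRate_mono {a b : ℝ} (ha : 0 ≤ a) (hab : a ≤ b) : adsRate a ≤ adsRate b :=
  le_of_tendsto_of_tendsto' (tendsto_adsRate ha) (tendsto_adsRate (ha.trans hab)) fun n =>
    Real.rpow_le_rpow (adsZ_nonneg n ha) (adsZ_mono n ha hab) (by positivity)

/-- **`κ` is convex in `α = log a`**: `e^{κ(a^θ b^{1-θ})} ≤ e^{θκ(a) + (1-θ)κ(b)}` (`a, b > 0`, `0 < θ < 1`), the limit of
Hölder's inequality `Zd.adsZ_rpow_mul_rpow_le`. [cite: BeatonGuttmannJensen2012Adsorption, §1 p. 1 (arXiv:1110.6695v1: «a convex, non-decreasing function of α»)]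
[cite: HammersleyTorrieWhittington1982, convexity of κ; reported in BeatonGuttmannJensen2012Adsorption §1 p. 1 (arXiv:1110.6695v1)] -/
theorem adsRate_logConvex {a b θ : ℝ} (ha : 0 < a) (hb : 0 < b) (hθ0 : 0 < θ) (hθ1 : θ < 1) :
    adsRate (a ^ θ * b ^ (1 - θ)) ≤ adsRate a ^ θ * adsRate b ^ (1 - θ) := by
  have hc : 0 ≤ a ^ θ * b ^ (1 - θ) := mul_nonneg (Real.rpow_nonneg ha.le _) (Real.rpow_nonneg hb.le _)
  have hlim : Tendsto (fun n : ℕ => ((adsZ n a) ^ (1 / (n : ℝ))) ^ θ * ((adsZ n b) ^ (1 / (n : ℝ))) ^ (1 - θ))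
      atTop (𝓝 (adsRate a ^ θ * adsRate b ^ (1 - θ))) :=
    ((tendsto_adsRate ha.le).rpow_const (Or.inr hθ0.le)).mul
      ((tendsto_adsRate hb.le).rpow_const (Or.inr (by linarith)))
  refine le_of_tendsto_of_tendsto' (tendsto_adsRate hc) hlim fun n => ?_
  have hZa := adsZ_nonneg n ha.le
  have hZb := adsZ_nonneg n hb.le
  calc (adsZ n (a ^ θ * b ^ (1 - θ))) ^ (1 / (n : ℝ))
      ≤ (adsZ n a ^ θ * adsZ n b ^ (1 - θ)) ^ (1 / (n : ℝ)) :=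
        Real.rpow_le_rpow (adsZ_nonneg n hc) (adsZ_rpow_mul_rpow_le n ha hb hθ0 hθ1) (by positivity)
    _ = ((adsZ n a) ^ (1 / (n : ℝ))) ^ θ * ((adsZ n b) ^ (1 / (n : ℝ))) ^ (1 - θ) := by
        rw [Real.mul_rpow (Real.rpow_nonneg hZa _) (Real.rpow_nonneg hZb _), ← Real.rpow_mul hZa, ← Real.rpow_mul hZa,
          ← Real.rpow_mul hZb, ← Real.rpow_mul hZb, mul_comm θ, mul_comm (1 - θ)]

/-! ### `AdsorbedAbove` and the free energy -/

/-- **An `AdsorbedAbove a Λ` certificate bounds the free energy from below: `Λ ≤ e^{κ(a)}`** (`a, Λ ≥ 0`):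
`(K Λⁿ)^{1/n} → Λ`. [cite: BeatonGuttmannJensen2012Adsorption, §1 (p. 2)] -/
theorem le_adsRate_of_adsorbedAbove {a Λ : ℝ} (ha : 0 ≤ a) (hΛ : 0 ≤ Λ) (h : AdsorbedAbove a Λ) : Λ ≤ adsRate a := by
  obtain ⟨K, hK, hKle⟩ := h
  -- `K^{1/n} Λ → Λ`
  have hK1 : Tendsto (fun n : ℕ => K ^ (1 / (n : ℝ)) * Λ) atTop (𝓝 Λ) := by
    have h1 : Tendsto (fun n : ℕ => K ^ (1 / (n : ℝ))) atTop (𝓝 1) := by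
      have h := tendsto_const_nhds.rpow tendsto_one_div_atTop_nhds_zero_nat (Or.inl hK.ne') (f := fun _ : ℕ => K)
      rwa [Real.rpow_zero] at h
    simpa using h1.mul_const Λ
  refine le_of_tendsto_of_tendsto hK1 (tendsto_adsRate ha) ?_
  filter_upwards [eventually_ge_atTop 1] with n hn
  calc K ^ (1 / (n : ℝ)) * Λ = (K * Λ ^ n) ^ (1 / (n : ℝ)) := by
        rw [Real.mul_rpow hK.le (pow_nonneg hΛ _), one_div, Real.pow_rpow_inv_natCast hΛ (by omega)]
    _ ≤ (adsZ n a) ^ (1 / (n : ℝ)) := Real.rpow_le_rpow (by positivity) (hKle n) (by positivity)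

/-- **Every rate below the free energy is certified: `Λ < e^{κ(a)}` ⇒ `AdsorbedAbove a Λ`** (`a ≥ 0`, `Λ > 0`):
eventually `Z⁺_n(a) ≥ Λⁿ`, and the finitely many earlier `n` are absorbed in the constant.
[cite: BeatonGuttmannJensen2012Adsorption, §1 (p. 2)] -/
theorem adsorbedAbove_of_lt_adsRate {a Λ : ℝ} (ha : 0 ≤ a) (hΛ0 : 0 < Λ) (h : Λ < adsRate a) : AdsorbedAbove a Λ := by
  have hZpos : ∀ n, 0 < adsZ n a := fun n =>
    lt_of_lt_of_le (by exact_mod_cast one_le_bridgeCount n) (bridgeCount_le_adsZ n ha)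
  -- eventually `Λ < Z⁺_n(a)^{1/n}`, i.e. `Λⁿ < Z⁺_n(a)`
  obtain ⟨N, hN⟩ := eventually_atTop.1 ((tendsto_adsRate ha).eventually (lt_mem_nhds h))
  have hlarge : ∀ n, N ≤ n → 1 ≤ n → Λ ^ n ≤ adsZ n a := by
    intro n hn h1
    have hlt := hN n hn
    have hnn : (n : ℝ) ≠ 0 := by exact_mod_cast (show n ≠ 0 by omega)
    have : (Λ ^ n : ℝ) = (Λ ^ (1 : ℝ)) ^ n := by rw [Real.rpow_one]
    calc Λ ^ n ≤ ((adsZ n a) ^ (1 / (n : ℝ))) ^ n := pow_le_pow_left₀ hΛ0.le hlt.le n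
      _ = adsZ n a := by
          rw [← Real.rpow_natCast, ← Real.rpow_mul (hZpos n).le, one_div, inv_mul_cancel₀ hnn, Real.rpow_one]
  -- the constant: `K = min(1, min_{n ≤ N} Z⁺_n(a)/Λⁿ)`
  set K := min 1 ((Finset.range (N + 1)).inf' ⟨0, by simp⟩ fun n => adsZ n a / Λ ^ n) with hK
  have hKpos : 0 < K := by
    refine lt_min zero_lt_one ?_
    refine (Finset.lt_inf'_iff _).2 fun n _ => div_pos (hZpos n) (pow_pos hΛ0 n)
  refine ⟨K, hKpos, fun n => ?_⟩
  rcases le_or_gt n N with hn | hn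
  · have hKle : K ≤ adsZ n a / Λ ^ n :=
      (min_le_right _ _).trans (Finset.inf'_le _ (Finset.mem_range.2 (Nat.lt_succ_of_le hn)))
    have := (le_div_iff₀ (pow_pos hΛ0 n)).1 hKle
    linarith
  · have h1 : K ≤ 1 := min_le_left _ _
    have := hlarge n hn.le (by omega)
    nlinarith [pow_pos hΛ0 n]

/-- **The walk is adsorbed at `a = 2.07`: `μ(ℤ²) < 2.69 ≤ e^{κ(2.07)}`** (the certified window of the tree, read on the
free energy; with `adsRate_eq_connectiveConstant`: `1 < a_c ≤ 2.07`).
[cite: BeatonGuttmannJensen2012Adsorption, §1 (p. 2)] -/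
theorem connectiveConstant_lt_adsRate_207 : connectiveConstant 2 < adsRate (207 / 100) :=
  connectiveConstant_two_lt_269.trans_le
    (le_adsRate_of_adsorbedAbove (by norm_num) (by norm_num) adsorbedAbove_207)

/-! ### The critical fugacity `a_c` -/

/-- **The critical fugacity `a_c = sup {a ≥ 0 : e^{κ(a)} = μ}`** («the existence of a critical value `α_c`»,
`a_c = e^{α_c}`; numerically `a_c = 1.77564`). [cite: BeatonGuttmannJensen2012Adsorption, §1 p. 2 (arXiv:1110.6695v1: «the existence of a critical value α_c»)] -/
def adsCriticalFugacity : ℝ := sSup {a : ℝ | 0 ≤ a ∧ adsRate a = connectiveConstant 2}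

/-- The desorbed set contains `1`. [cite: BeatonGuttmannJensen2012Adsorption, §1 p. 2 (arXiv:1110.6695v1: «the existence of a critical value α_c»)] -/
theorem desorbedSet_nonempty : ({a : ℝ | 0 ≤ a ∧ adsRate a = connectiveConstant 2} : Set ℝ).Nonempty :=
  ⟨1, zero_le_one, adsRate_eq_connectiveConstant zero_le_one le_rfl⟩

/-- Every fugacity with `e^{κ(a)} = μ` is at most `μ` (`a ≤ e^{κ(a)}`): «`0 ≤ α_c ≤ log μ`».
[cite: BeatonGuttmannJensen2012Adsorption, §1 p. 2 (arXiv:1110.6695v1: «0 ≤ α_c ≤ log μ»)] -/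
theorem le_connectiveConstant_of_adsRate_eq {a : ℝ} (ha : 0 ≤ a) (h : adsRate a = connectiveConstant 2) :
    a ≤ connectiveConstant 2 :=
  h ▸ self_le_adsRate ha

/-- The desorbed set is bounded above (by `μ`). [cite: BeatonGuttmannJensen2012Adsorption, §1 p. 2 (arXiv:1110.6695v1: «0 ≤ α_c ≤ log μ»)] -/
theorem desorbedSet_bddAbove : BddAbove ({a : ℝ | 0 ≤ a ∧ adsRate a = connectiveConstant 2} : Set ℝ) :=
  ⟨connectiveConstant 2, fun _ hb => le_connectiveConstant_of_adsRate_eq hb.1 hb.2⟩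

/-- Every fugacity with `e^{κ(a)} = μ` is at most `2.07` (`Zd.connectiveConstant_lt_adsRate_207` and monotonicity).
[cite: BeatonGuttmannJensen2012Adsorption, §1 (p. 2)] -/
theorem le_207_of_adsRate_eq {a : ℝ} (h : adsRate a = connectiveConstant 2) : a ≤ 207 / 100 := by
  by_contra hlt
  have hmono := adsRate_mono (by norm_num : (0 : ℝ) ≤ 207 / 100) (not_le.1 hlt).le
  have h207 := connectiveConstant_lt_adsRate_207
  linarith

/-- **`1 ≤ a_c`** (the desorbed phase contains `[0, 1]`). [cite: BeatonGuttmannJensen2012Adsorption, §1 p. 2 (arXiv:1110.6695v1: «the existence of a critical value α_c»)] -/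
theorem one_le_adsCriticalFugacity : 1 ≤ adsCriticalFugacity :=
  le_csSup desorbedSet_bddAbove
    (show (1 : ℝ) ∈ {a : ℝ | 0 ≤ a ∧ adsRate a = connectiveConstant 2} from
      ⟨zero_le_one, adsRate_eq_connectiveConstant zero_le_one le_rfl⟩)

/-- **`a_c ≤ μ`** — as printed: «`0 ≤ α_c ≤ log μ`». [cite: BeatonGuttmannJensen2012Adsorption, §1 p. 2 (arXiv:1110.6695v1: «0 ≤ α_c ≤ log μ»)] -/
theorem adsCriticalFugacity_le_connectiveConstant : adsCriticalFugacity ≤ connectiveConstant 2 :=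
  csSup_le desorbedSet_nonempty fun _ hb => le_connectiveConstant_of_adsRate_eq hb.1 hb.2

/-- **`a_c ≤ 2.07`** — the certified upper bound of the tree (`Zd.adsorbedAbove_207`, census of irreducible wall-returning
`x`-bridges to length `20`) read on the critical fugacity itself. [cite: BeatonGuttmannJensen2012Adsorption, §1 p. 2 (arXiv:1110.6695v1: «the existence of a critical value α_c»)] -/
theorem adsCriticalFugacity_le_207 : adsCriticalFugacity ≤ 207 / 100 :=
  csSup_le desorbedSet_nonempty fun _ hb => le_207_of_adsRate_eq hb.2

/-- **`a_c < μ(ℤ²)` strictly** — the lane's certified improvement of the printed window `1 ≤ a_c ≤ μ` (BGJ 2012: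
«`0 ≤ α_c ≤ log μ`»): `a_c ≤ 2.07 < 1 + √2 ≤ μ(ℤ²)` (Temperley's bound, `Zd.DimTransfer.one_add_sqrt_two_le_connectiveConstant_two`).
[cite: BeatonGuttmannJensen2012Adsorption, §1 p. 2 (arXiv:1110.6695v1: «0 ≤ α_c ≤ log μ»)] -/
theorem adsCriticalFugacity_lt_connectiveConstant : adsCriticalFugacity < connectiveConstant 2 := by
  have h := DimTransfer.one_add_sqrt_two_le_connectiveConstant_two
  have hs : (1.41 : ℝ) < Real.sqrt 2 := by
    rw [show (1.41 : ℝ) = Real.sqrt (1.41 ^ 2) by rw [Real.sqrt_sq (by norm_num)]]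
    exact Real.sqrt_lt_sqrt (by norm_num) (by norm_num)
  linarith [adsCriticalFugacity_le_207]

/-- **Below `a_c` the walk is desorbed: `e^{κ(a)} = μ`** (`0 ≤ a < a_c`). [cite: BeatonGuttmannJensen2012Adsorption, §1 p. 2 (arXiv:1110.6695v1: «the existence of a critical value α_c»)] -/
theorem adsRate_eq_of_lt_adsCriticalFugacity {a : ℝ} (ha : 0 ≤ a) (h : a < adsCriticalFugacity) :
    adsRate a = connectiveConstant 2 := by
  obtain ⟨b, ⟨-, hb⟩, hab⟩ := exists_lt_of_lt_csSup desorbedSet_nonempty h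
  exact le_antisymm (hb ▸ adsRate_mono ha hab.le) (connectiveConstant_le_adsRate ha)

/-- **Above `a_c` the walk is adsorbed: `e^{κ(a)} > μ`** (`a_c < a`). [cite: BeatonGuttmannJensen2012Adsorption, §1 p. 2 (arXiv:1110.6695v1: «the existence of a critical value α_c»)] -/
theorem connectiveConstant_lt_adsRate_of_adsCriticalFugacity_lt {a : ℝ} (h : adsCriticalFugacity < a) :
    connectiveConstant 2 < adsRate a := by
  have ha : 0 ≤ a := zero_le_one.trans (one_le_adsCriticalFugacity.trans h.le)
  refine lt_of_le_of_ne (connectiveConstant_le_adsRate ha) fun heq => ?_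
  have : a ≤ adsCriticalFugacity :=
    le_csSup desorbedSet_bddAbove (show a ∈ {a : ℝ | 0 ≤ a ∧ adsRate a = connectiveConstant 2} from ⟨ha, heq.symm⟩)
  linarith

/-! ### The free energy `κ(α)` itself, as printed -/

/-- **`κ(α) = lim n⁻¹ log Z_n(α)`** with `a = e^α` the surface fugacity: `κ(α) = log e^{κ}(e^α)`.
[cite: BeatonGuttmannJensen2012Adsorption, §1 p. 1 (arXiv:1110.6695v1)] -/
def adsFreeEnergy (α : ℝ) : ℝ := Real.log (adsRate (Real.exp α))

/-- **«For `α < 0`, `κ(α) = log μ`»** (and at `α = 0`). [cite: BeatonGuttmannJensen2012Adsorption, §1 p. 2 (arXiv:1110.6695v1: «For α < 0, κ(α) = log μ»)]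
[cite: OwczarekWhittington2009InteractingPolygons, §12.2.1 eq. (12.16)] -/
theorem adsFreeEnergy_eq_log_connectiveConstant {α : ℝ} (hα : α ≤ 0) :
    adsFreeEnergy α = Real.log (connectiveConstant 2) := by
  rw [adsFreeEnergy, adsRate_eq_connectiveConstant (Real.exp_pos α).le (Real.exp_le_one_iff.2 hα)]

/-- **«For `α ≥ 0`, `κ(α) ≥ max[log μ, α]`»**. [cite: BeatonGuttmannJensen2012Adsorption, §1 p. 2 (arXiv:1110.6695v1: «κ(α) ≥ max[log μ, α]»)]
[cite: OwczarekWhittington2009InteractingPolygons, §12.2.1 eq. (12.15)] -/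
theorem max_le_adsFreeEnergy {α : ℝ} (hα : 0 ≤ α) : max (Real.log (connectiveConstant 2)) α ≤ adsFreeEnergy α := by
  have h1 : (1 : ℝ) ≤ Real.exp α := Real.one_le_exp hα
  have hR := adsRate_pos (zero_le_one.trans h1)
  refine max_le ?_ ?_
  · exact Real.log_le_log (connectiveConstant_pos 2) (connectiveConstant_le_adsRate (zero_le_one.trans h1))
  · calc α = Real.log (Real.exp α) := (Real.log_exp α).symm
      _ ≤ adsFreeEnergy α := Real.log_le_log (Real.exp_pos α) (self_le_adsRate (Real.exp_pos α).le)

/-- **«`κ(α) ≤ κ₂ + α`, `α ≥ 0`»** (`κ₂ = log μ(ℤ²)`). [cite: OwczarekWhittington2009InteractingPolygons, §12.2.1 eq. (12.15)] -/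
theorem adsFreeEnergy_le {α : ℝ} (hα : 0 ≤ α) : adsFreeEnergy α ≤ Real.log (connectiveConstant 2) + α := by
  have h1 : (1 : ℝ) ≤ Real.exp α := Real.one_le_exp hα
  calc adsFreeEnergy α ≤ Real.log (Real.exp α * connectiveConstant 2) :=
        Real.log_le_log (adsRate_pos (zero_le_one.trans h1)) (adsRate_le_mul_connectiveConstant h1)
    _ = Real.log (connectiveConstant 2) + α := by
        rw [Real.log_mul (Real.exp_pos α).ne' (connectiveConstant_pos 2).ne', Real.log_exp]; ring

/-- **«a non-decreasing function of `α`»**. [cite: BeatonGuttmannJensen2012Adsorption, §1 p. 1 (arXiv:1110.6695v1: «a convex, non-decreasing function of α»)] -/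
theorem monotone_adsFreeEnergy : Monotone adsFreeEnergy := fun _ _ h =>
  Real.log_le_log (adsRate_pos (Real.exp_pos _).le)
    (adsRate_mono (Real.exp_pos _).le (Real.exp_le_exp.2 h))

/-- **«`κ(α)` is a convex function of `α`»** (the limit of Hölder's inequality on `Z⁺_n`).
[cite: BeatonGuttmannJensen2012Adsorption, §1 p. 1 (arXiv:1110.6695v1: «a convex, non-decreasing function of α»)]
[cite: HammersleyTorrieWhittington1982, convexity of κ; reported in BeatonGuttmannJensen2012Adsorption §1 p. 1 (arXiv:1110.6695v1)] -/
theorem convexOn_adsFreeEnergy : ConvexOn ℝ Set.univ adsFreeEnergy := by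
  refine LinearOrder.convexOn_of_lt convex_univ fun x _ y _ _ a b ha hb hab => ?_
  have hb' : b = 1 - a := by linarith
  subst hb'
  have ha1 : a < 1 := by linarith
  have hx := Real.exp_pos x
  have hy := Real.exp_pos y
  have hRx := adsRate_pos hx.le
  have hRy := adsRate_pos hy.le
  simp only [smul_eq_mul, adsFreeEnergy]
  have hexp : Real.exp (a * x + (1 - a) * y) = Real.exp x ^ a * Real.exp y ^ (1 - a) := by
    rw [Real.exp_add, mul_comm a x, mul_comm (1 - a) y, Real.exp_mul, Real.exp_mul]
  rw [hexp]
  have hconv := adsRate_logConvex hx hy ha ha1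
  have hpos : 0 < adsRate (Real.exp x ^ a * Real.exp y ^ (1 - a)) :=
    adsRate_pos (mul_nonneg (Real.rpow_nonneg hx.le _) (Real.rpow_nonneg hy.le _))
  calc Real.log (adsRate (Real.exp x ^ a * Real.exp y ^ (1 - a)))
      ≤ Real.log (adsRate (Real.exp x) ^ a * adsRate (Real.exp y) ^ (1 - a)) := Real.log_le_log hpos hconv
    _ = a * Real.log (adsRate (Real.exp x)) + (1 - a) * Real.log (adsRate (Real.exp y)) := by
        rw [Real.log_mul (Real.rpow_pos_of_pos hRx _).ne' (Real.rpow_pos_of_pos hRy _).ne',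
          Real.log_rpow hRx, Real.log_rpow hRy]

/-- **«and therefore continuous»**. [cite: BeatonGuttmannJensen2012Adsorption, §1 p. 1 (arXiv:1110.6695v1: «therefore continuous and almost everywhere differentiable»)] -/
theorem continuous_adsFreeEnergy : Continuous adsFreeEnergy :=
  convexOn_adsFreeEnergy.locallyLipschitz.continuous

/-- **«and almost everywhere differentiable»** (a monotone function; Lebesgue).
[cite: BeatonGuttmannJensen2012Adsorption, §1 p. 1 (arXiv:1110.6695v1: «therefore continuous and almost everywhere differentiable»)] -/
theorem ae_differentiableAt_adsFreeEnergy : ∀ᵐ α, DifferentiableAt ℝ adsFreeEnergy α :=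
  monotone_adsFreeEnergy.ae_differentiableAt

/-- **The transition point itself is desorbed: `κ(α_c) = log μ`** (`κ` is continuous and equals `log μ` on `α < α_c`).
[cite: BeatonGuttmannJensen2012Adsorption, §1 p. 2 (arXiv:1110.6695v1: «the existence of a critical value α_c»)] -/
theorem adsFreeEnergy_log_adsCriticalFugacity :
    adsFreeEnergy (Real.log adsCriticalFugacity) = Real.log (connectiveConstant 2) := by
  set αc := Real.log adsCriticalFugacity with hαc
  have hac : 0 < adsCriticalFugacity := zero_lt_one.trans_le one_le_adsCriticalFugacity
  have h1 : Tendsto adsFreeEnergy (𝓝[<] αc) (𝓝 (adsFreeEnergy αc)) :=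
    continuous_adsFreeEnergy.continuousAt.tendsto.mono_left nhdsWithin_le_nhds
  have h2 : Tendsto adsFreeEnergy (𝓝[<] αc) (𝓝 (Real.log (connectiveConstant 2))) := by
    refine tendsto_const_nhds.congr' ?_
    filter_upwards [self_mem_nhdsWithin] with α hα
    have hlt : Real.exp α < adsCriticalFugacity := by
      rwa [Set.mem_Iio, hαc, Real.lt_log_iff_exp_lt hac] at hα
    rw [adsFreeEnergy, adsRate_eq_of_lt_adsCriticalFugacity (Real.exp_pos α).le hlt]
  exact tendsto_nhds_unique h1 h2

/-- **`e^{κ(a_c)} = μ`**: at the critical fugacity the free energy is still `log μ`.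
[cite: BeatonGuttmannJensen2012Adsorption, §1 p. 2 (arXiv:1110.6695v1: «the existence of a critical value α_c»)] -/
theorem adsRate_adsCriticalFugacity : adsRate adsCriticalFugacity = connectiveConstant 2 := by
  have hac : 0 < adsCriticalFugacity := zero_lt_one.trans_le one_le_adsCriticalFugacity
  have h := adsFreeEnergy_log_adsCriticalFugacity
  rw [adsFreeEnergy, Real.exp_log hac] at h
  exact Real.log_injOn_pos (Set.mem_Ioi.2 (adsRate_pos hac.le)) (Set.mem_Ioi.2 (connectiveConstant_pos 2)) h

end Literature.Probability.RandomPlanarGeometry.SAW.Zd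

namespace Literature.Probability.RandomPlanarGeometry.SAW.Zd

/-! ### `κ(α) ∼ α` as `α → ∞` (Rychlewski–Whittington 2011, as reported by BGJ 2012) -/

/-- **`κ(α)/α → 1` as `α → ∞`** («The situation as `α → ∞` has only recently been rigorously established by Rychlewski and
Whittington [RW11], who proved that `κ(α)` is asymptotic to `α` in this regime») — here an immediate consequence of
`α ≤ κ(α) ≤ log μ + α`. [cite: BeatonGuttmannJensen2012Adsorption, §1 p. 2 (arXiv:1110.6695v1: «κ(α) is asymptotic to α»)]
[cite: OwczarekWhittington2009InteractingPolygons, §12.2.1 eq. (12.15)] -/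
theorem tendsto_adsFreeEnergy_div : Tendsto (fun α : ℝ => adsFreeEnergy α / α) atTop (𝓝 1) := by
  have h1 : Tendsto (fun α : ℝ => Real.log (connectiveConstant 2) / α) atTop (𝓝 0) :=
    tendsto_const_nhds.div_atTop tendsto_id
  have hup : Tendsto (fun α : ℝ => 1 + Real.log (connectiveConstant 2) / α) atTop (𝓝 1) := by
    simpa using (tendsto_const_nhds (x := (1 : ℝ))).add h1
  refine tendsto_of_tendsto_of_tendsto_of_le_of_le' tendsto_const_nhds hup ?_ ?_
  · filter_upwards [eventually_gt_atTop 0] with α hα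
    rw [le_div_iff₀ hα, one_mul]
    exact le_trans (le_max_right _ _) (max_le_adsFreeEnergy hα.le)
  · filter_upwards [eventually_gt_atTop 0] with α hα
    rw [div_le_iff₀ hα, add_mul, one_mul, div_mul_cancel₀ _ hα.ne']
    have := adsFreeEnergy_le hα.le
    linarith

end Literature.Probability.RandomPlanarGeometry.SAW.Zd

namespace Literature.Probability.RandomPlanarGeometry.SAW.Zd

/-! ### Strict monotonicity above the transition -/

/-- **`κ` is strictly increasing on `[α_c, ∞)`** (`α_c = log a_c`): `κ` is convex, `κ(α_c) = log μ`, and `κ(α) > log μ`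
for `α > α_c` by the definition of `a_c`. Printed (implicitly): convexity and «Since `κ(a) = log μ_d` if `a ≤ 1` and
`κ(a) > log μ_d` if `a > a_c^o`, there is an adsorption transition in the model where `E(a)` becomes strictly positive»
(`E(a) = a dκ/da`) — label CONSOLIDATION (lit-2 g16, 2026-08-23). [cite: JansevanRensburgWhittington2013, §3.1 (arXiv v4 p. 6: E_±(a) = a d^±κ/da; p. 9: «κ(a) > log μ_d if a > a_c^o … E(a) becomes strictly positive»)]
[cite: BeatonGuttmannJensen2012Adsorption, §1 p. 1 (arXiv:1110.6695v1: «a convex, non-decreasing function of α»)] -/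
theorem strictMonoOn_adsFreeEnergy : StrictMonoOn adsFreeEnergy (Set.Ici (Real.log adsCriticalFugacity)) := by
  intro x hx y _ hxy
  have hac : 0 < adsCriticalFugacity := zero_lt_one.trans_le one_le_adsCriticalFugacity
  have hx' : Real.log adsCriticalFugacity ≤ x := hx
  have hy' : adsCriticalFugacity < Real.exp y := by
    rw [← Real.exp_log hac]
    exact Real.exp_lt_exp.2 (lt_of_le_of_lt hx' hxy)
  have hκy : Real.log (connectiveConstant 2) < adsFreeEnergy y :=
    Real.log_lt_log (connectiveConstant_pos 2) (connectiveConstant_lt_adsRate_of_adsCriticalFugacity_lt hy')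
  rcases eq_or_lt_of_le hx' with hxe | hxl
  · rw [← hxe, adsFreeEnergy_log_adsCriticalFugacity]
    exact hκy
  · have hκx : Real.log (connectiveConstant 2) ≤ adsFreeEnergy x := by
      rw [← adsFreeEnergy_log_adsCriticalFugacity]
      exact monotone_adsFreeEnergy hxl.le
    rcases eq_or_lt_of_le hκx with heq | hlt
    · rw [← heq]; exact hκy
    · have hslope := convexOn_adsFreeEnergy.slope_mono_adjacent (Set.mem_univ _) (Set.mem_univ _) hxl hxy
      rw [adsFreeEnergy_log_adsCriticalFugacity] at hslope
      have h1 : 0 < (adsFreeEnergy x - Real.log (connectiveConstant 2)) / (x - Real.log adsCriticalFugacity) :=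
        div_pos (by linarith) (by linarith)
      have h2 := (div_pos_iff_of_pos_right (show (0 : ℝ) < y - x by linarith)).1 (h1.trans_le hslope)
      linarith

/-- **`e^{κ}` is strictly increasing on `[a_c, ∞)`.** [cite: JansevanRensburgWhittington2013, §3.1 (arXiv v4 p. 9: «κ(a) > log μ_d if a > a_c^o … E(a) becomes strictly positive»)]
[cite: BeatonGuttmannJensen2012Adsorption, §1 p. 1 (arXiv:1110.6695v1: «a convex, non-decreasing function of α»)] -/
theorem strictMonoOn_adsRate : StrictMonoOn adsRate (Set.Ici adsCriticalFugacity) := by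
  intro a ha b _ hab
  have hac : 0 < adsCriticalFugacity := zero_lt_one.trans_le one_le_adsCriticalFugacity
  have ha' : adsCriticalFugacity ≤ a := ha
  have ha0 : 0 < a := hac.trans_le ha'
  have hb0 : 0 < b := ha0.trans hab
  have h := strictMonoOn_adsFreeEnergy (Set.mem_Ici.2 (Real.log_le_log hac ha'))
    (Set.mem_Ici.2 (Real.log_le_log hac (ha'.trans hab.le))) (Real.log_lt_log ha0 hab)
  simp only [adsFreeEnergy, Real.exp_log ha0, Real.exp_log hb0] at h
  exact (Real.log_lt_log_iff (adsRate_pos ha0.le) (adsRate_pos hb0.le)).1 h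

end Literature.Probability.RandomPlanarGeometry.SAW.Zd
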